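import Literature.Computability.AlgebraicComplexity.CKSV22GeneralABPLowerBound
import Literature.Computability.AlgebraicComplexity.Kum19HomogeneousABPGeneral
import Mathlib.Data.Fin.Tuple.Sort
import HarnessLib

/-!
# Layered ABPs are ABPs of bounded formal degree (Chatterjee–Kumar–She–Volk 2022, §3)

P. Chatterjee, M. Kumar, A. She, B. L. Volk, *Quadratic lower bounds for algebraic branching programs
and formulas*, comput. complex. **31** (2022) 8 (arXiv:1911.11793) [ChatterjeeKumarSheVolk2022].

The paper works with two renderings of an algebraic branching program: the layered graph of Def. 1
("a layered graph where each edge is labeled by an affine linear form and the first and the last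
layer have one vertex each", p0003; in the tree: `LayeredABPComputes` / `LayeredABPDegComputes`)
and the unlayered directed acyclic graph with its formal degree (§2, p0008: "Our directed graphs are
always acyclic with designated source vertex `s` and sink vertex `t` … The formal degree of a vertex
… `fdeg(u) = max_i (deg(ℓ_i) + fdeg(u_i))`"; in the tree: `Kumar2019.ABPDegFormalDegreeComputes`),
and passes between them silently: Def. 5 (p0009) "This model is an intermediate model between
(layered) ABPs and unlayered ABPs: given a multilayered ABP of size `τ` it is straightforward to
construct an unlayered ABP of size `O(τ)` which computes the same polynomial", and the proof of
Thm. 1.1 (p0012) "Note that if `d_0` is at most `n/Δ`, then by Theorem 7 [an ABP of formal degree at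
most `n`] … we are done" — a program with `d_0` layers and labels of degree `≤ Δ` has formal degree
at most `(d_0 − 1)·Δ`.

This file proves that passage for the tree's two renderings
(`CKSV2022.abpDegFormalDegreeComputes_of_layered`): the layered program on `k` vertices with edge
labels of degree `≤ Δ` whose end vertex lies `L` layers above its start vertex is, after renumbering
the vertices along the layers (`Tuple.sort`) and discarding the edges that no `s–t` path can use
(into `s`, out of `t`, below the layer of `s`), an acyclic program on the same `k` vertices with the
formal-degree labelling `φ(v) = (layer v − layer s)·Δ`, of formal degree `≤ L·Δ`, computing the same
polynomial; packaged on the predicates as `LayeredABPDegComputes.exists_abpDegFormalDegreeComputes`.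
In particular the robust bound `chatterjeeKumarSheVolk2022_thm_7_general` applies to layered
programs with few layers, as the printed proof of Thm. 1.1 uses it.

D-0026: no named facts; everything is a theorem.

## References
* [ChatterjeeKumarSheVolk2022] P. Chatterjee, M. Kumar, A. She, B. L. Volk, comput. complex. 31
  (2022) 8, doi:10.1007/s00037-022-00223-8, arXiv:1911.11793 — Def. 1, §2 (formal degree), Def. 5,
  proof of Thm. 1.1 (§3.2).
-/

noncomputable section

open MvPolynomial Matrix Finset

namespace Literature.Computability.AlgebraicComplexity

namespace CKSV2022

section LayeredToDag

variable {K : Type*} [CommRing K] {n : ℕ}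

/-- Powers commute with renumbering the vertices. [folklore] -/
private theorem submatrix_pow {k : ℕ} (σ : Equiv.Perm (Fin k))
    (X : Matrix (Fin k) (Fin k) (MvPolynomial (Fin n) K)) (j : ℕ) :
    (X ^ j).submatrix σ σ = X.submatrix σ σ ^ j := by
  induction j with
  | zero => rw [pow_zero, pow_zero, Matrix.submatrix_one_equiv]
  | succ j ih => rw [pow_succ, pow_succ, Matrix.submatrix_mul _ _ σ σ σ σ.bijective, ih]

/-- The path-sum matrix of the empty graph is the identity (only the empty paths).
[cite: ChatterjeeKumarSheVolk2022, §2] -/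
private theorem pathSum_zero {k : ℕ} (hk : 0 < k) :
    Kumar2019.pathSum (0 : Matrix (Fin k) (Fin k) (MvPolynomial (Fin n) K)) = 1 := by
  obtain ⟨k', rfl⟩ : ∃ k', k = k' + 1 := ⟨k - 1, by omega⟩
  rw [Kumar2019.pathSum, Finset.sum_range_succ', pow_zero]
  rw [Finset.sum_eq_zero fun j _ => zero_pow (Nat.succ_ne_zero j), zero_add]

/-- **A layered ABP is an ABP of formal degree `≤ L·Δ`** (`L` = number of layers above the start
vertex at which the end vertex sits), on the same vertices and computing the same polynomial — the
passage between Def. 1 and the unlayered model of §2 used in Def. 5 (p0009: "given a multilayered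
ABP … it is straightforward to construct an unlayered ABP … which computes the same polynomial") and
in the proof of Thm. 1.1 (p0012: few layers ⇒ Theorem 7 applies). The vertices are renumbered along
the layers, the edges into `s`, out of `t` and below the layer of `s` (used by no `s–t` path) are
dropped, and `φ(v) = (layer v − layer s)·Δ` is a formal-degree labelling.
[cite: ChatterjeeKumarSheVolk2022, Definition 5, Theorem 1.1 (proof)] -/
theorem abpDegFormalDegreeComputes_of_layered {k Δ : ℕ} (layer : Fin k → ℕ) (s t : Fin k)
    (N : Matrix (Fin k) (Fin k) (MvPolynomial (Fin n) K))
    (hlay : ∀ u v, N u v ≠ 0 → layer v = layer u + 1) (hdeg : ∀ u v, (N u v).totalDegree ≤ Δ) :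
    Kumar2019.ABPDegFormalDegreeComputes k Δ ((layer t - layer s) * Δ)
      ((N ^ (layer t - layer s)) s t) := by
  classical
  have hk : 0 < k := Fin.pos s
  set D := layer t - layer s with hDdef
  by_cases hD0 : D = 0
  · -- no layer to climb: the computed polynomial is the constant `[s = t]`, computed by the empty graph
    refine ⟨s, t, 0, fun _ => 0, fun u v h => absurd rfl h, fun _ => rfl, fun _ => rfl,
      fun _ _ => by rw [Matrix.zero_apply, totalDegree_zero]; exact Nat.zero_le _, rfl,
      Nat.zero_le _, fun u v h => absurd rfl h, ?_⟩
    rw [pathSum_zero hk, hD0, pow_zero]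
  -- renumber the vertices along the layers
  let σ : Equiv.Perm (Fin k) := Tuple.sort layer
  have hmono : Monotone (layer ∘ σ) := Tuple.monotone_sort layer
  -- drop the useless edges
  let N₀ : Matrix (Fin k) (Fin k) (MvPolynomial (Fin n) K) :=
    Matrix.of fun u v => if layer u < layer s ∨ u = t ∨ v = s then 0 else N u v
  have hN₀ : ∀ u v, N₀ u v ≠ 0 → ¬ (layer u < layer s ∨ u = t ∨ v = s) ∧ N₀ u v = N u v := by
    intro u v h
    by_cases hc : layer u < layer s ∨ u = t ∨ v = s
    · exact absurd (by simp only [N₀, Matrix.of_apply]; rw [if_pos hc]) h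
    · exact ⟨hc, by simp only [N₀, Matrix.of_apply]; rw [if_neg hc]⟩
  have hlay₀ : ∀ u v, N₀ u v ≠ 0 → layer v = layer u + 1 := fun u v h =>
    hlay u v (by rw [← (hN₀ u v h).2]; exact h)
  let N' : Matrix (Fin k) (Fin k) (MvPolynomial (Fin n) K) := N₀.submatrix σ σ
  have hN' : ∀ i j, N' i j = N₀ (σ i) (σ j) := fun _ _ => rfl
  -- acyclicity in the new numbering
  have htop : Kumar2019.IsTopological N' := by
    intro i j h
    rw [hN'] at h
    have hl := hlay₀ _ _ h
    by_contra hij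
    have := hmono (not_lt.1 hij)
    simp only [Function.comp] at this
    omega
  refine ⟨σ.symm s, σ.symm t, N', fun i => (layer (σ i) - layer s) * Δ, htop, fun u => ?_, fun v => ?_,
    fun i j => ?_, by simp, by simp [hDdef], fun i j h => ?_, ?_⟩
  · -- no edges into `s`
    rw [hN', Equiv.apply_symm_apply]
    simp [N₀, Matrix.of_apply]
  · -- no edges out of `t`
    rw [hN', Equiv.apply_symm_apply]
    simp [N₀, Matrix.of_apply]
  · -- label degrees
    rw [hN']
    simp only [N₀, Matrix.of_apply]
    split_ifs
    · rw [totalDegree_zero]; exact Nat.zero_le _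
    · exact hdeg _ _
  · -- the formal-degree labelling climbs by `Δ ≥ deg` along every surviving edge
    rw [hN'] at h ⊢
    obtain ⟨hc, hNN⟩ := hN₀ _ _ h
    have hl := hlay₀ _ _ h
    rw [hNN]
    have h1 : layer (σ j) - layer s = (layer (σ i) - layer s) + 1 := by omega
    show (layer (σ i) - layer s) * Δ + (N (σ i) (σ j)).totalDegree ≤ (layer (σ j) - layer s) * Δ
    rw [h1, Nat.succ_mul]
    exact Nat.add_le_add_left (hdeg _ _) _
  · -- the computed polynomial
    -- powers in the new numbering are renumbered powers
    have hpow : ∀ j, (N' ^ j) (σ.symm s) (σ.symm t) = (N₀ ^ j) s t := by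
      intro j
      rw [show N' = N₀.submatrix σ σ from rfl, ← submatrix_pow, Matrix.submatrix_apply,
        Equiv.apply_symm_apply, Equiv.apply_symm_apply]
    -- (R) below the layer of `t`, row `s` of the powers is unchanged by dropping the useless edges
    have hR : ∀ (j : ℕ) (v : Fin k), layer v ≤ layer t → (N₀ ^ j) s v = (N ^ j) s v := by
      intro j
      induction j with
      | zero => intro v _; rw [pow_zero, pow_zero]
      | succ j ih =>
        intro v hv
        rw [pow_succ, pow_succ, Matrix.mul_apply, Matrix.mul_apply]
        refine Finset.sum_congr rfl fun w _ => ?_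
        by_cases hNwv : N w v = 0
        · have : N₀ w v = 0 := by
            simp only [N₀, Matrix.of_apply]
            split_ifs
            · rfl
            · exact hNwv
          rw [this, hNwv, mul_zero, mul_zero]
        have hlv := hlay w v hNwv
        rw [ih w (by omega)]
        by_cases hw : (N ^ j) s w = 0
        · rw [hw, zero_mul, zero_mul]
        have hlw := layer_eq_of_pow_apply_ne_zero hlay s j w hw
        congr 1
        simp only [N₀, Matrix.of_apply]
        rw [if_neg]
        rintro (h1 | h2 | h3)
        · omega
        · rw [h2] at hlv; omega
        · rw [h3] at hlv; omega
    -- (Z) only the `D`-th power reaches `t`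
    have hZ : ∀ j, j ≠ D → (N₀ ^ j) s t = 0 := by
      intro j hj
      by_contra h
      have := layer_eq_of_pow_apply_ne_zero hlay₀ s j t h
      omega
    rw [Kumar2019.pathSum, Matrix.sum_apply]
    simp_rw [hpow]
    rw [Finset.sum_eq_single D (fun j _ hj => hZ j hj)]
    · exact hR D t le_rfl
    · -- if `D ≥ k` the computed polynomial vanishes anyway
      intro hDk
      rw [Finset.mem_range, not_lt] at hDk
      by_contra h
      have h' : (N' ^ D) (σ.symm s) (σ.symm t) ≠ 0 := by
        rw [hpow]; exact h
      have := htop.le_of_pow_apply_ne_zero D _ _ h'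
      have ht : ((σ.symm t : Fin k) : ℕ) < k := (σ.symm t).isLt
      omega

/-- **Def. 1 ⊆ the unlayered model of §2**, on the predicates: a polynomial computed by a layered
ABP on at most `m` vertices with edge labels of degree `≤ Δ` is computed by an ABP (Kumar's Def. 1
rendering, `Kumar2019.ABPDegFormalDegreeComputes`) on at most `m` vertices with labels of degree
`≤ Δ` and formal degree `≤ L·Δ` for some `L` (the number of layers climbed).
[cite: ChatterjeeKumarSheVolk2022, Definition 5, Theorem 1.1 (proof)] -/
theorem _root_.Literature.Computability.AlgebraicComplexity.LayeredABPDegComputes.exists_abpDegFormalDegreeComputes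
    {m Δ : ℕ} {g : MvPolynomial (Fin n) K} (h : LayeredABPDegComputes m Δ g) :
    ∃ k, k ≤ m ∧ ∃ L : ℕ, g.totalDegree ≤ L * Δ ∧ Kumar2019.ABPDegFormalDegreeComputes k Δ (L * Δ) g := by
  obtain ⟨k, hk, layer, s, t, N, hlay, hdeg, hcomp⟩ := h
  refine ⟨k, hk, layer t - layer s, ?_, hcomp ▸ abpDegFormalDegreeComputes_of_layered layer s t N hlay hdeg⟩
  -- degree bound: a product of `L` labels of degree `≤ Δ`
  rw [← hcomp]
  have : ∀ (j : ℕ) (u v : Fin k), ((N ^ j) u v).totalDegree ≤ j * Δ := by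
    intro j
    induction j with
    | zero =>
      intro u v
      rw [pow_zero, Matrix.one_apply]
      split_ifs
      · rw [totalDegree_one]; exact Nat.zero_le _
      · rw [totalDegree_zero]; exact Nat.zero_le _
    | succ j ih =>
      intro u v
      rw [pow_succ, Matrix.mul_apply]
      refine (totalDegree_finsetSum _ _).trans (Finset.sup_le fun w _ => ?_)
      refine (totalDegree_mul _ _).trans ?_
      have h1 := ih u w
      have h2 := hdeg w v
      rw [Nat.succ_mul]
      omega
  exact this _ s t

end LayeredToDag

end CKSV2022

end Literature.Computability.AlgebraicComplexity
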